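import Summits.AtomisticToContinuum.FouriersLaw.Theses.HeatModeWeylLaw
import Summits.AtomisticToContinuum.FouriersLaw.Theorems.HeatModeWeylLawSineModeBasics

/-!
# Birth skeleton (BC3) for crux `WeylLimit` (stmt-AtomisticToContinuum-12395)

Route `HeatModeWeylLaw` (sub-problem `FouriersLaw`), crux r4 `WeylLimit` = on the diffusive clock
`t = N²s` the normalised equilibrium autocorrelation `c_N(N²s)/V_N` of the Dirichlet sine energy mode
of `pinnedChain ω₂ lam β γ` (Langevin baths at equal temperature `T`) converges into the one-parameter
family `exp(-π² D_th s)`, `D_th ≥ 0`, or to `0` for every `s > 0` (the `D_th = ∞` end).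

## The line: EXISTENCE + ONE-MODE MARKOV CLOSURE, glued by Cauchy's functional equation

The family `{s ↦ e^{-π² D s} : D ≥ 0} ∪ {0 on (0,∞)}` is EXACTLY the set of functions
`φ : (0,∞) → ℝ` that are (i) bounded above by `1` and (ii) multiplicative, `φ(s+u) = φ(s)φ(u)`.
So the crux splits into two independent analytic halves and one fixed-`N` support bound:

* `stub_autocorrLeVariance` — `c_N(t) ≤ V_N` (stationarity + Cauchy–Schwarz + kernel Jensen; size M);
* `stub_scalingLimitExists` — the pointwise limit `φ(s) = lim_N c_N(N²s)/V_N` exists for `s > 0`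
  (compactness is free, uniqueness of the hydrodynamic limit point is the content);
* `stub_asymptoticSemigroupLaw` — the memory defect
  `c_N(N²(s+u))/V_N − (c_N(N²s)/V_N)(c_N(N²u)/V_N)` vanishes as `N → ∞` (Chapman–Kolmogorov + Krein
  symmetry + "the sine mode is asymptotically an exact eigenfunction").

`WeylLimit_of : Stmt.stub_autocorrLeVariance → Stmt.stub_scalingLimitExists →
Stmt.stub_asymptoticSemigroupLaw → HeatModeWeylLaw.WeylLimit` (hypotheses = the stub statements BY
NAME, `Stmt.*` abbreviations of the verbatim signatures; kernel-checked, no `sorry`, axioms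
propext/Classical.choice/Quot.sound) composes them into the crux BY NAME: the limit `φ` is
multiplicative (uniqueness of limits), `0 ≤ φ ≤ 1`, hence either `φ` vanishes identically on `(0,∞)`
(second branch, via `φ((n+1)s) = φ(s)^(n+1)`) or `φ > 0` is antitone with `φ(m/n) = φ(1)^(m/n)`, and a
floor/squeeze argument gives `φ(s) = exp(-a s)`, `a = -log φ(1) ≥ 0`, i.e. `D_th = a/π²`; the value at
`s = 0` is `c_N(0)/V_N = 1` by `P_0 = id` (`pinnedChain_transitionKernel_zero`) and `V_N > 0`
(`Theorems.sineModeBasics_proof`, the proved item `SineModeBasics`).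

Neither analytic stub implies the crux (two-mode limits exist but are not multiplicative; the
semigroup law asserts no convergence), neither mentions `FouriersLaw`, and the support stub is a
fixed-`N` inequality: BC3 probes `stub → WeylLimit`, `stub → FouriersLaw` by
`first | exact? | simpa | aesop` fail for all three (see the registrar's NOTES / evidence).
-/

namespace Summit.AtomisticToContinuum.FouriersLaw.Cruxes.WeylLimit.Birth

open Filter Topology MeasureTheory ProbabilityTheory
open Literature.MathematicalPhysics.KineticTheory.HeatConduction

/-- **Cauchy's functional equation on the diffusive clock (the glue, proved).** If a family of
sequences `f s : ℕ → ℝ` (`s ≥ 0`) converges pointwise on `s > 0`, has asymptotically multiplicative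
increments `f (s+u) N - f s N * f u N → 0`, is eventually `≤ 1` for `s > 0` and eventually `= 1` at
`s = 0`, then its limit lies in the Weyl family: `exp(-π² D s)` for some `D ≥ 0` (all `s ≥ 0`), or `0`
for all `s > 0`. [folklore] -/
theorem expFamily_of_asymptotic_semigroup (f : ℝ → ℕ → ℝ)
    (hlim : ∃ φ : ℝ → ℝ, ∀ s : ℝ, 0 < s → Tendsto (f s) atTop (𝓝 (φ s)))
    (hmul : ∀ s u : ℝ, 0 < s → 0 < u →
      Tendsto (fun N : ℕ => f (s + u) N - f s N * f u N) atTop (𝓝 0))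
    (hle : ∀ s : ℝ, 0 < s → ∀ᶠ N : ℕ in atTop, f s N ≤ 1)
    (hzero : ∀ᶠ N : ℕ in atTop, f 0 N = 1) :
    ∃ Dth : ℝ, 0 ≤ Dth ∧
      ((∀ s : ℝ, 0 ≤ s → Tendsto (f s) atTop (𝓝 (Real.exp (-(Real.pi ^ 2 * Dth * s))))) ∨
        (∀ s : ℝ, 0 < s → Tendsto (f s) atTop (𝓝 0))) := by
  obtain ⟨φ, hφ⟩ := hlim
  -- (A) the limit is multiplicative on `(0, ∞)` (uniqueness of limits)
  have hA : ∀ s u : ℝ, 0 < s → 0 < u → φ (s + u) = φ s * φ u := by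
    intro s u hs hu
    have h1 : Tendsto (fun N : ℕ => f (s + u) N - f s N * f u N) atTop
        (𝓝 (φ (s + u) - φ s * φ u)) :=
      (hφ (s + u) (add_pos hs hu)).sub ((hφ s hs).mul (hφ u hu))
    exact sub_eq_zero.mp (tendsto_nhds_unique h1 (hmul s u hs hu))
  -- (B) the limit is bounded by one
  have hB : ∀ s : ℝ, 0 < s → φ s ≤ 1 := fun s hs => le_of_tendsto (hφ s hs) (hle s hs)
  -- (C) powers: `φ ((n+1) s) = φ s ^ (n+1)`
  have hC : ∀ s : ℝ, 0 < s → ∀ n : ℕ, φ (((n : ℝ) + 1) * s) = φ s ^ (n + 1) := by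
    intro s hs n
    induction n with
    | zero => simp
    | succ n ih =>
      have h : (((n + 1 : ℕ) : ℝ) + 1) * s = ((n : ℝ) + 1) * s + s := by push_cast; ring
      rw [h, hA _ _ (by positivity) hs, ih]
      ring
  -- (D) the limit is nonnegative: `φ s = φ (s/2)²`
  have hD : ∀ s : ℝ, 0 < s → 0 ≤ φ s := by
    intro s hs
    have h := hA (s / 2) (s / 2) (by positivity) (by positivity)
    rw [add_halves] at h
    rw [h]
    exact mul_self_nonneg _
  by_cases hpos : ∀ s : ℝ, 0 < s → 0 < φ s
  · -- Case `φ > 0` on `(0, ∞)`: `φ s = exp (-a s)` with `a = -log φ 1 ≥ 0`.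
    have h1pos : 0 < φ 1 := hpos 1 one_pos
    obtain ⟨a, ha⟩ : ∃ a : ℝ, a = -Real.log (φ 1) := ⟨_, rfl⟩
    have ha0 : 0 ≤ a := by
      rw [ha, neg_nonneg]
      exact Real.log_nonpos (hD 1 one_pos) (hB 1 one_pos)
    have hexpa : Real.exp (-a) = φ 1 := by rw [ha, neg_neg, Real.exp_log h1pos]
    -- antitone on `(0, ∞)`
    have hanti : ∀ s t : ℝ, 0 < s → s ≤ t → φ t ≤ φ s := by
      intro s t hs hst
      rcases eq_or_lt_of_le hst with h | h
      · rw [h]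
      · have hm := hA s (t - s) hs (by linarith)
        rw [show s + (t - s) = t by ring] at hm
        rw [hm]
        exact mul_le_of_le_one_right (hD s hs) (hB _ (by linarith))
    -- roots: `φ (1/(n+1)) = exp (-a/(n+1))`
    have hroot : ∀ n : ℕ, φ (1 / ((n : ℝ) + 1)) = Real.exp (-a / ((n : ℝ) + 1)) := by
      intro n
      have hn : (0 : ℝ) < (n : ℝ) + 1 := by positivity
      have hy : 0 < φ (1 / ((n : ℝ) + 1)) := hpos _ (by positivity)
      have hpow1 : φ (1 / ((n : ℝ) + 1)) ^ (n + 1) = φ 1 := by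
        rw [← hC _ (by positivity) n, mul_one_div_cancel hn.ne']
      have hpow2 : Real.exp (-a / ((n : ℝ) + 1)) ^ (n + 1) = φ 1 := by
        rw [← Real.exp_nat_mul, ← hexpa]
        congr 1
        push_cast
        field_simp
      exact (pow_left_inj₀ hy.le (Real.exp_pos _).le (Nat.succ_ne_zero n)).mp
        (hpow1.trans hpow2.symm)
    -- positive rationals `(m+1)/(n+1)`
    have hrat : ∀ m n : ℕ, φ (((m : ℝ) + 1) / ((n : ℝ) + 1)) =
        Real.exp (-(a * (((m : ℝ) + 1) / ((n : ℝ) + 1)))) := by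
      intro m n
      have hn : (0 : ℝ) < (n : ℝ) + 1 := by positivity
      rw [div_eq_mul_one_div, hC _ (by positivity) m, hroot n, ← Real.exp_nat_mul]
      congr 1
      push_cast
      field_simp
    -- two-sided squeeze through `⌊(n+1) s⌋`
    have hsq : ∀ s : ℝ, 0 < s → ∀ n : ℕ,
        Real.exp (-(a * (s + 1 / ((n : ℝ) + 1)))) ≤ φ s ∧
          φ s ≤ Real.exp (-(a * (s - 1 / ((n : ℝ) + 1)))) := by
      intro s hs n
      have hn : (0 : ℝ) < (n : ℝ) + 1 := by positivity
      obtain ⟨m, hm1, hm2⟩ : ∃ m : ℕ, (m : ℝ) ≤ ((n : ℝ) + 1) * s ∧ ((n : ℝ) + 1) * s < (m : ℝ) + 1 :=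
        ⟨⌊((n : ℝ) + 1) * s⌋₊, Nat.floor_le (by positivity), Nat.lt_floor_add_one _⟩
      constructor
      · -- lower bound: `s ≤ (m+1)/(n+1) ≤ s + 1/(n+1)`
        have hle : s ≤ ((m : ℝ) + 1) / ((n : ℝ) + 1) := by
          rw [le_div_iff₀ hn]
          nlinarith
        have hle' : a * (((m : ℝ) + 1) / ((n : ℝ) + 1)) ≤ a * (s + 1 / ((n : ℝ) + 1)) := by
          apply mul_le_mul_of_nonneg_left _ ha0
          rw [div_le_iff₀ hn, add_mul, one_div_mul_cancel hn.ne']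
          nlinarith
        calc Real.exp (-(a * (s + 1 / ((n : ℝ) + 1))))
            ≤ Real.exp (-(a * (((m : ℝ) + 1) / ((n : ℝ) + 1)))) := Real.exp_le_exp.mpr (by linarith)
          _ = φ (((m : ℝ) + 1) / ((n : ℝ) + 1)) := (hrat m n).symm
          _ ≤ φ s := hanti s _ hs hle
      · -- upper bound
        rcases m with _ | k
        · -- `m = 0`: `s < 1/(n+1)`, the bound is `φ s ≤ 1 ≤ exp (nonneg)`
          have hs1 : ((n : ℝ) + 1) * s < 1 := by simpa using hm2
          have hx : 0 ≤ -(a * (s - 1 / ((n : ℝ) + 1))) := by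
            have h1 : s ≤ 1 / ((n : ℝ) + 1) := by
              rw [le_div_iff₀ hn]
              nlinarith
            have h2 := mul_nonneg ha0 (sub_nonneg.mpr h1)
            nlinarith
          calc φ s ≤ 1 := hB s hs
            _ ≤ Real.exp (-(a * (s - 1 / ((n : ℝ) + 1)))) := by
              linarith [Real.add_one_le_exp (-(a * (s - 1 / ((n : ℝ) + 1))))]
        · -- `m = k+1 ≥ 1`: `s - 1/(n+1) ≤ (k+1)/(n+1) ≤ s`
          have hk1 : (k : ℝ) + 1 ≤ ((n : ℝ) + 1) * s := by
            have : ((k + 1 : ℕ) : ℝ) = (k : ℝ) + 1 := by push_cast; ring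
            linarith [this ▸ hm1]
          have hle : ((k : ℝ) + 1) / ((n : ℝ) + 1) ≤ s := by
            rw [div_le_iff₀ hn]
            nlinarith
          have hle' : a * (s - 1 / ((n : ℝ) + 1)) ≤ a * (((k : ℝ) + 1) / ((n : ℝ) + 1)) := by
            apply mul_le_mul_of_nonneg_left _ ha0
            rw [le_div_iff₀ hn, sub_mul, one_div_mul_cancel hn.ne']
            have : ((k + 1 : ℕ) : ℝ) + 1 = (k : ℝ) + 1 + 1 := by push_cast; ring
            nlinarith [this ▸ hm2]
          calc φ s ≤ φ (((k : ℝ) + 1) / ((n : ℝ) + 1)) := hanti _ s (by positivity) hle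
            _ = Real.exp (-(a * (((k : ℝ) + 1) / ((n : ℝ) + 1)))) := hrat k n
            _ ≤ Real.exp (-(a * (s - 1 / ((n : ℝ) + 1)))) := Real.exp_le_exp.mpr (by linarith)
    -- pass to the limit `n → ∞` in the squeeze
    have hlim1 : Tendsto (fun n : ℕ => 1 / ((n : ℝ) + 1)) atTop (𝓝 0) :=
      tendsto_one_div_add_atTop_nhds_zero_nat
    have hmain : ∀ s : ℝ, 0 < s → φ s = Real.exp (-(a * s)) := by
      intro s hs
      have hlo : Tendsto (fun n : ℕ => Real.exp (-(a * (s + 1 / ((n : ℝ) + 1))))) atTop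
          (𝓝 (Real.exp (-(a * s)))) := by
        have h := ((hlim1.const_add s).const_mul a).neg
        simp only [add_zero] at h
        exact (Real.continuous_exp.tendsto _).comp h
      have hhi : Tendsto (fun n : ℕ => Real.exp (-(a * (s - 1 / ((n : ℝ) + 1))))) atTop
          (𝓝 (Real.exp (-(a * s)))) := by
        have h := ((hlim1.const_sub s).const_mul a).neg
        simp only [sub_zero] at h
        exact (Real.continuous_exp.tendsto _).comp h
      exact le_antisymm (ge_of_tendsto' hhi fun n => (hsq s hs n).2)
        (le_of_tendsto' hlo fun n => (hsq s hs n).1)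
    -- conclude with `D_th = a / π²`
    have hpi : Real.pi ^ 2 * (a / Real.pi ^ 2) = a := by
      field_simp
    refine ⟨a / Real.pi ^ 2, div_nonneg ha0 (sq_nonneg _), Or.inl fun s hs => ?_⟩
    rcases eq_or_lt_of_le hs with h | h
    · subst h
      simp only [mul_zero, neg_zero, Real.exp_zero]
      exact tendsto_const_nhds.congr' (hzero.mono fun N hN => hN.symm)
    · have he : Real.exp (-(Real.pi ^ 2 * (a / Real.pi ^ 2) * s)) = Real.exp (-(a * s)) := by
        rw [hpi]
      rw [he, ← hmain s h]
      exact hφ s h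
  · -- Case `φ s₀ ≤ 0` for some `s₀ > 0`: then `φ s₀ = 0` and `φ` vanishes on `(0, ∞)`.
    have hpos' : ∃ s₀ : ℝ, 0 < s₀ ∧ φ s₀ ≤ 0 := by
      by_contra h
      exact hpos fun s hs => not_le.mp fun hle => h ⟨s, hs, hle⟩
    obtain ⟨s₀, hs₀, hφs₀⟩ := hpos'
    have hz : φ s₀ = 0 := le_antisymm hφs₀ (hD s₀ hs₀)
    refine ⟨0, le_rfl, Or.inr fun s hs => ?_⟩
    obtain ⟨n, hn⟩ := exists_nat_gt (s₀ / s)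
    have hbig : s₀ < ((n : ℝ) + 1) * s := by
      rw [div_lt_iff₀ hs] at hn
      nlinarith
    have h1 : φ (((n : ℝ) + 1) * s) = 0 := by
      have hm := hA s₀ (((n : ℝ) + 1) * s - s₀) hs₀ (by linarith)
      rw [show s₀ + (((n : ℝ) + 1) * s - s₀) = ((n : ℝ) + 1) * s by ring] at hm
      rw [hm, hz, zero_mul]
    have h2 : φ s ^ (n + 1) = 0 := by rw [← hC s hs n, h1]
    have h3 : φ s = 0 := (pow_eq_zero_iff (Nat.succ_ne_zero n)).mp h2
    have h4 := hφ s hs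
    rwa [h3] at h4

/-- **stub 1 (fixed-`N` stationarity–contraction bound).** For every `N ≥ 1` and `t ≥ 0` the
equilibrium autocorrelation of the centred sine energy mode is bounded by its Gibbs variance,
`c_N(t) ≤ V_N`: Cauchy–Schwarz in `L²(μ_N)` plus `‖K_t ê‖² ≤ ⟨K_t(ê²)⟩ = ⟨ê²⟩` (Jensen for the Markov
kernels `K_t` and INVARIANCE of the Gibbs measure, the proved item `GibbsKernelInvariant`,
`Theorems.gibbsKernelInvariant_proof`); junk values of the Bochner integrals only help (`0 ≤ V_N`).
Size M (kernel Jensen + integrability of `ê²` under `K_t(x,·)` for `μ_N`-a.e. `x`). It supplies the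
one-sided bound `φ ≤ 1` without which the limit family would include growing exponentials. -/
theorem stub_autocorrLeVariance : ∀ ω₂ lam β γ : ℝ, 0 < ω₂ → 0 < lam → 0 < β → 0 < γ → ∀ T : ℝ, 0 < T → (let P := Literature.MathematicalPhysics.KineticTheory.HeatConduction.pinnedChain ω₂ lam β γ; let e : (N : ℕ) → Literature.MathematicalPhysics.KineticTheory.HeatConduction.PhaseSpace N → ℝ := fun N x => (∑ i : Fin N, Real.sin (Real.pi * ((i : ℝ) + 1 / 2) / N) * (x.2 i ^ 2 / 2 + P.U (x.1 i))) + ∑ i : Fin N, ∑ j : Fin N, (if j.val = i.val + 1 then (Real.sin (Real.pi * ((i : ℝ) + 1 / 2) / N) + Real.sin (Real.pi * ((j : ℝ) + 1 / 2) / N)) / 2 * P.V (x.1 j - x.1 i) else 0); let V : ℕ → ℝ := fun N => ∫ x, (e N x - ∫ y, e N y ∂(P.gibbsMeasure N T)) ^ 2 ∂(P.gibbsMeasure N T); let c : ℕ → ℝ → ℝ := fun N t => ∫ x, (e N x - ∫ y, e N y ∂(P.gibbsMeasure N T)) * (∫ y, (e N y - ∫ z, e N z ∂(P.gibbsMeasure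 N T)) ∂(P.transitionKernel N T T t.toNNReal x)) ∂(P.gibbsMeasure N T); ∀ N : ℕ, 1 ≤ N → ∀ t : ℝ, 0 ≤ t → c N t ≤ V N) := by
  sorry

/-- **stub 2 (EXISTENCE of the diffusive-clock scaling limit).** For every `s > 0` the normalised
autocorrelation `c_N(N²s)/V_N` converges as `N → ∞` (to some `φ(s)`): tightness is free
(`|c_N| ≤ V_N`), the content is UNIQUENESS of subsequential limits — the hydrodynamic limit of the
equilibrium energy fluctuation of the anharmonic chain on the `N²` clock (Bernardin2014 §2.2.1 "a
challenging open problem"; OllaSasada2013 / KomorowskiOllaSimon2021 for noisy versions). This is the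
half of the crux that can fail by size resonances / slow crossovers (`N²λ₁(N)` oscillating). It does
NOT give the crux: a two-mode limit `p e^{-as} + (1-p) e^{-bs}` exists but is outside the family. -/
theorem stub_scalingLimitExists : ∀ ω₂ lam β γ : ℝ, 0 < ω₂ → 0 < lam → 0 < β → 0 < γ → ∀ T : ℝ, 0 < T → (let P := Literature.MathematicalPhysics.KineticTheory.HeatConduction.pinnedChain ω₂ lam β γ; let e : (N : ℕ) → Literature.MathematicalPhysics.KineticTheory.HeatConduction.PhaseSpace N → ℝ := fun N x => (∑ i : Fin N, Real.sin (Real.pi * ((i : ℝ) + 1 / 2) / N) * (x.2 i ^ 2 / 2 + P.U (x.1 i))) + ∑ i : Fin N, ∑ j : Fin N, (if j.val = i.val + 1 then (Real.sin (Real.pi * ((i : ℝ) + 1 / 2) / N) + Real.sin (Real.pi * ((j : ℝ) + 1 / 2) / N)) / 2 * P.V (x.1 j - x.1 i) else 0); let V : ℕ → ℝ := fun N => ∫ x, (e N x - ∫ y, e N y ∂(P.gibbsMeasure N T)) ^ 2 ∂(P.gibbsMeasure N T); let c : ℕ → ℝ → ℝ := fun N t => ∫ x, (e N x - ∫ y,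 e N y ∂(P.gibbsMeasure N T)) * (∫ y, (e N y - ∫ z, e N z ∂(P.gibbsMeasure N T)) ∂(P.transitionKernel N T T t.toNNReal x)) ∂(P.gibbsMeasure N T); ∃ φ : ℝ → ℝ, ∀ s : ℝ, 0 < s → Filter.Tendsto (fun N : ℕ => c N ((N : ℝ) ^ 2 * s) / V N) Filter.atTop (nhds (φ s))) := by
  sorry

/-- **stub 3 (ASYMPTOTIC SEMIGROUP LAW = one-mode Markov closure).** On the diffusive clock the
sine mode forgets its memory kernel: `c_N(N²(s+u))/V_N - (c_N(N²s)/V_N)·(c_N(N²u)/V_N) → 0` for all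
`s, u > 0`. Mechanism: Chapman–Kolmogorov `K_{N²(s+u)} = K_{N²u} ∘ K_{N²s}` (proved,
`pinnedChain_transitionKernel_add`) + Krein/momentum-flip symmetry (`KreinSymmetry`, proved) reduce the
defect to the correlation of `K_{N²s}ê` with the component of `K_{N²u}ê` ORTHOGONAL to `ê`, which must
be `o(V_N)`: "one real hydrodynamic mode asymptotically carries all of the sine-mode variance"
(`sin(πx)` is an exact eigenfunction of the limiting Dirichlet heat semigroup). This is the half that
fails under a second even slow density (two-exponential limits violate multiplicativity). It does NOT
give the crux: it asserts no convergence. -/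
theorem stub_asymptoticSemigroupLaw : ∀ ω₂ lam β γ : ℝ, 0 < ω₂ → 0 < lam → 0 < β → 0 < γ → ∀ T : ℝ, 0 < T → (let P := Literature.MathematicalPhysics.KineticTheory.HeatConduction.pinnedChain ω₂ lam β γ; let e : (N : ℕ) → Literature.MathematicalPhysics.KineticTheory.HeatConduction.PhaseSpace N → ℝ := fun N x => (∑ i : Fin N, Real.sin (Real.pi * ((i : ℝ) + 1 / 2) / N) * (x.2 i ^ 2 / 2 + P.U (x.1 i))) + ∑ i : Fin N, ∑ j : Fin N, (if j.val = i.val + 1 then (Real.sin (Real.pi * ((i : ℝ) + 1 / 2) / N) + Real.sin (Real.pi * ((j : ℝ) + 1 / 2) / N)) / 2 * P.V (x.1 j - x.1 i) else 0); let V : ℕ → ℝ := fun N => ∫ x, (e N x - ∫ y, e N y ∂(P.gibbsMeasure N T)) ^ 2 ∂(P.gibbsMeasure N T); let c : ℕ → ℝ → ℝ := fun N t => ∫ x, (e N x - ∫ y, e N y ∂(P.gibbsMeasure N T)) * (∫ y, (e N y - ∫ z, e N z ∂(P.gibbsMeasure N T)) ∂(P.transitionKernel N T T t.toNNReal x)) ∂(P.gibbsMeasure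 N T); ∀ s u : ℝ, 0 < s → 0 < u → Filter.Tendsto (fun N : ℕ => c N ((N : ℝ) ^ 2 * (s + u)) / V N - (c N ((N : ℝ) ^ 2 * s) / V N) * (c N ((N : ℝ) ^ 2 * u) / V N)) Filter.atTop (nhds 0)) := by
  sorry

/-! ### By-name statements of the three registered stubs

The skeleton audit (`#h21_check_skeleton`, A12) admits as hypotheses of the composing theorem only
registered obligations or declared stubs BY NAME (head constant = stub name); the abbreviations below
are the stub signatures verbatim (generated from the same text), so `WeylLimit_of` is literally
`stub_autocorrLeVariance → stub_scalingLimitExists → stub_asymptoticSemigroupLaw → WeylLimit`. -/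
namespace Stmt

/-- Statement of registered stub 1 (`stub_autocorrLeVariance`), by name. -/
abbrev stub_autocorrLeVariance : Prop := ∀ ω₂ lam β γ : ℝ, 0 < ω₂ → 0 < lam → 0 < β → 0 < γ → ∀ T : ℝ, 0 < T → (let P := Literature.MathematicalPhysics.KineticTheory.HeatConduction.pinnedChain ω₂ lam β γ; let e : (N : ℕ) → Literature.MathematicalPhysics.KineticTheory.HeatConduction.PhaseSpace N → ℝ := fun N x => (∑ i : Fin N, Real.sin (Real.pi * ((i : ℝ) + 1 / 2) / N) * (x.2 i ^ 2 / 2 + P.U (x.1 i))) + ∑ i : Fin N, ∑ j : Fin N, (if j.val = i.val + 1 then (Real.sin (Real.pi * ((i : ℝ) + 1 / 2) / N) + Real.sin (Real.pi * ((j : ℝ) + 1 / 2) / N)) / 2 * P.V (x.1 j - x.1 i) else 0); let V : ℕ → ℝ := fun N => ∫ x, (e N x - ∫ y, e N y ∂(P.gibbsMeasure N T)) ^ 2 ∂(P.gibbsMeasure N T); let c : ℕ → ℝ → ℝ := fun N t => ∫ x, (e N x - ∫ y, e N y ∂(P.gibbsMeasure N T)) * (∫ y, (e N y - ∫ z, e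 N z ∂(P.gibbsMeasure N T)) ∂(P.transitionKernel N T T t.toNNReal x)) ∂(P.gibbsMeasure N T); ∀ N : ℕ, 1 ≤ N → ∀ t : ℝ, 0 ≤ t → c N t ≤ V N)

/-- Statement of registered stub 2 (`stub_scalingLimitExists`), by name. -/
abbrev stub_scalingLimitExists : Prop := ∀ ω₂ lam β γ : ℝ, 0 < ω₂ → 0 < lam → 0 < β → 0 < γ → ∀ T : ℝ, 0 < T → (let P := Literature.MathematicalPhysics.KineticTheory.HeatConduction.pinnedChain ω₂ lam β γ; let e : (N : ℕ) → Literature.MathematicalPhysics.KineticTheory.HeatConduction.PhaseSpace N → ℝ := fun N x => (∑ i : Fin N, Real.sin (Real.pi * ((i : ℝ) + 1 / 2) / N) * (x.2 i ^ 2 / 2 + P.U (x.1 i))) + ∑ i : Fin N, ∑ j : Fin N, (if j.val = i.val + 1 then (Real.sin (Real.pi * ((i : ℝ) + 1 / 2) / N) + Real.sin (Real.pi * ((j : ℝ) + 1 / 2) / N)) / 2 * P.V (x.1 j - x.1 i) else 0); let V : ℕ → ℝ := fun N => ∫ x, (e N x - ∫ y, e N y ∂(P.gibbsMeasure N T)) ^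 2 ∂(P.gibbsMeasure N T); let c : ℕ → ℝ → ℝ := fun N t => ∫ x, (e N x - ∫ y, e N y ∂(P.gibbsMeasure N T)) * (∫ y, (e N y - ∫ z, e N z ∂(P.gibbsMeasure N T)) ∂(P.transitionKernel N T T t.toNNReal x)) ∂(P.gibbsMeasure N T); ∃ φ : ℝ → ℝ, ∀ s : ℝ, 0 < s → Filter.Tendsto (fun N : ℕ => c N ((N : ℝ) ^ 2 * s) / V N) Filter.atTop (nhds (φ s)))

/-- Statement of registered stub 3 (`stub_asymptoticSemigroupLaw`), by name. -/
abbrev stub_asymptoticSemigroupLaw : Prop := ∀ ω₂ lam β γ : ℝ, 0 < ω₂ → 0 < lam → 0 < β → 0 < γ → ∀ T : ℝ, 0 < T → (let P := Literature.MathematicalPhysics.KineticTheory.HeatConduction.pinnedChain ω₂ lam β γ; let e : (N : ℕ) → Literature.MathematicalPhysics.KineticTheory.HeatConduction.PhaseSpace N → ℝ := fun N x => (∑ i : Fin N, Real.sin (Real.pi * ((i : ℝ) + 1 / 2) / N) * (x.2 i ^ 2 / 2 + P.U (x.1 i))) + ∑ i : Fin N, ∑ j : Fin N, (if j.val = i.val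 + 1 then (Real.sin (Real.pi * ((i : ℝ) + 1 / 2) / N) + Real.sin (Real.pi * ((j : ℝ) + 1 / 2) / N)) / 2 * P.V (x.1 j - x.1 i) else 0); let V : ℕ → ℝ := fun N => ∫ x, (e N x - ∫ y, e N y ∂(P.gibbsMeasure N T)) ^ 2 ∂(P.gibbsMeasure N T); let c : ℕ → ℝ → ℝ := fun N t => ∫ x, (e N x - ∫ y, e N y ∂(P.gibbsMeasure N T)) * (∫ y, (e N y - ∫ z, e N z ∂(P.gibbsMeasure N T)) ∂(P.transitionKernel N T T t.toNNReal x)) ∂(P.gibbsMeasure N T); ∀ s u : ℝ, 0 < s → 0 < u → Filter.Tendsto (fun N : ℕ => c N ((N : ℝ) ^ 2 * (s + u)) / V N - (c N ((N : ℝ) ^ 2 * s) / V N) * (c N ((N : ℝ) ^ 2 * u) / V N)) Filter.atTop (nhds 0))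

end Stmt

/-- **Composition into the crux BY NAME** (kernel-checked, no `sorry`): the three stubs imply
`HeatModeWeylLaw.WeylLimit`. Fixed-`N` inputs proved here: `c_N(N²s)/V_N ≤ 1` eventually (stub 1 and
`V_N > 0`, `Theorems.sineModeBasics_proof`) and `c_N(0)/V_N = 1` (`P_0 = id`,
`pinnedChain_transitionKernel_zero`, `integral_dirac`); then `expFamily_of_asymptotic_semigroup`. -/
theorem WeylLimit_of (hB : Stmt.stub_autocorrLeVariance) (hE : Stmt.stub_scalingLimitExists)
    (hM : Stmt.stub_asymptoticSemigroupLaw) :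
    Summit.AtomisticToContinuum.FouriersLaw.Theses.HeatModeWeylLaw.WeylLimit := by
  intro ω₂ lam β γ hω hl hβ hγ T hT
  have hB' := hB ω₂ lam β γ hω hl hβ hγ T hT
  have hE' := hE ω₂ lam β γ hω hl hβ hγ T hT
  have hM' := hM ω₂ lam β γ hω hl hβ hγ T hT
  have hS := Summit.AtomisticToContinuum.FouriersLaw.Theorems.sineModeBasics_proof
    ω₂ lam β γ hω hl hβ hγ T hT
  dsimp only at hB' hE' hM' hS ⊢
  refine expFamily_of_asymptotic_semigroup _ hE' hM' ?_ ?_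
  · intro s hs
    filter_upwards [Filter.eventually_ge_atTop 1] with N hN
    have hV := (hS N hN).2
    have hNs : (0 : ℝ) ≤ (N : ℝ) ^ 2 * s := by positivity
    exact (div_le_one hV).mpr (hB' N hN _ hNs)
  · filter_upwards [Filter.eventually_ge_atTop 1] with N hN
    have hV := (hS N hN).2
    rw [div_eq_one_iff_eq hV.ne', mul_zero, Real.toNNReal_zero,
      pinnedChain_transitionKernel_zero hω hl.le hβ.le hγ.le N T T]
    simp only [Kernel.id_apply, integral_dirac]
    refine integral_congr_ae (ae_of_all _ fun x => ?_)
    ring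

end Summit.AtomisticToContinuum.FouriersLaw.Cruxes.WeylLimit.Birth
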